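/-
Copyright: seat `ym-line-cbag-p2` (prover-ym-line-cbag-p2-g2-0), route `ColdBoxAllGroups`, crux `BulkAllGroups`
(stmt-QuantumFields-22255), line `dlr-chessboard-G` (skeleton `Cruxes/BulkAllGroups/Lines/birth.lean` v5): stub
`stub_kernelMeanExpansionG`, the expansion at ONE `β` and ONE near-centre plaquette (everything but the exponent bookkeeping).
-/
import Summits.QuantumFields.YangMills.Theorems.ColdBoxAllGroupsBulkAllGroupsKernelCovDatumAtBetaG
import Summits.QuantumFields.YangMills.Theorems.ColdBoxAllGroupsBulkAllGroupsKernelMeanDatumCoreG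

/-!
# Crux `BulkAllGroups` (stmt-QuantumFields-22255), line `dlr-chessboard-G`, skeleton v5, stub `stub_kernelMeanExpansionG`: the one-scale expansion
# of a deep kernel MEAN with a crude-good datum AT ONE `β` and one near-centre plaquette, every compact group presented in `U(N)` —
# `kernelMeanG_sub_interface_le`

The `G`-port of the body of the PROVED `SU(2)` stub `stub_kernelMeanExpansion` (`…BulkDominatesColdBoxWStubKernelMeanExpansion`): the mean core
with datum `abs_kernelMeanG_sub_gaussian_le_datum` (lead p2) at the forest-fixed truncated gauge copy `W` of a datum `ω` charted by `ϑ` (package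
data as hypotheses), at the plaquette `(x; 1,2)` for `x` within `H/8` of the centre (`near_centre_mem_plaquettesTouching`), with its Gaussian-window
inputs DISCHARGED (T4 `abs_tiltWDE_le`, R3-datum `abs_beta_mul_plaqCostAt_sub_qObsDE_le`, the goodTDE sandwich `gaussD_real_compl_goodTDE_inter_ball_le`,
the background bound `abs_dirBackground_sdatE_le`, window coordinates `norm_extDatum_le_of_window` — w2/p1), the kernel mean TRANSPORTED back to
`ω` (`integral_plaqCostAt_boxKernelG_eq_of_gauge_trunc_of_near_centre`, w2), and the Gaussian value `(D/2)V + ½Σ_c F'_c²` converted to the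
interface's `(D/2)V + β·Σ_c F̄⁰_c²` for the half-scaled datum `ϑ⁰ = ϑ/√2` (`half_beta_sum_dirBackground_sq_eq`, w3).  All bookkeeping quantities
are free real parameters constrained by explicit inequalities, discharged eventually in `β` by `eventually_kernelDatum_boundsG` (p1) in
`…StubKernelMeanExpansionG`.  No sorry; no new definition; standard axioms.  NOT a claim about the mass gap (rung-level support R2xi-G `XiPow`,
RECORD label); the Yang–Mills mass gap is NOT proved by this.
-/

set_option autoImplicit false

noncomputable section

open MeasureTheory ProbabilityTheory Finset Real Filter Topology Metric
open scoped ENNReal Matrix.Norms.Frobenius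
open Literature.Probability.LatticeModels (Site glueWith)
open Literature.MathematicalPhysics.QuantumLattice
open Literature.MathematicalPhysics.QuantumFieldTheory
open Literature.MathematicalPhysics.QuantumFieldTheory.LatticeMaxwell
open Literature.MathematicalPhysics.QuantumFieldTheory.AxialGauge
open Summit.QuantumFields.YangMills.Theorems.WeakCouplingRates
open Summit.QuantumFields.YangMills.Theorems.FreeEnergyLogCoefficient

namespace Summit.QuantumFields.YangMills.Theorems.ColdBoxAllGroups

section Box

variable {N : ℕ} {G : Type} [Group G] [TopologicalSpace G] [IsTopologicalGroup G] [CompactSpace G]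
  [MeasurableSpace G] [BorelSpace G] [SecondCountableTopology G]
variable (ρ : G →* Matrix (Fin N) (Fin N) ℂ)

set_option maxHeartbeats 800000 in
/-- **The one-scale expansion of a deep kernel mean at ONE `β` and one near-centre plaquette, every compact group presented in `U(N)`.**  See the
module docstring; the bound is `2(2Nβ)pY + (M(e^{2w}−1) + τ + 2(1 + 2D²(R'⁴+3))√P)` with `M = β^{2ε}`, `τ = 190βm³`,
`w = 120(2H+1)⁴τ + 4(2H+1)⁴ℓ`, `P = 240D(2H+1)⁴e^{−R²/2}`. -/
theorem kernelMeanG_sub_interface_le (hρc : Continuous ρ) (hinj : Function.Injective ρ) (hρu : ∀ g, ρ g ∈ Matrix.unitaryGroup (Fin N) ℂ)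
    {β ε r m ℓ B R R' pY : ℝ} {H : ℕ} (hβ1 : 1 ≤ β) (hH : 1 ≤ H)
    (ω : LGConfig 4 G) (g : Site 4 → G) {ϑ : Fin (dimE ρ) → (Literature.MathematicalPhysics.QuantumLattice.ZdEdge 4 → ℝ)}
    {s : Fin (dimE ρ) → (DirFree H → ℝ)}
    (hWall : ∀ e, forestFix H (glueWith (boxEdgesAt dirCorner (2 * H + 3))
      (fun e' : ↥(boxEdgesAt dirCorner (2 * H + 3)) => gaugeTransformZd g ω e'.1) (fun _ => 1)) e = expChart ρ (datVec ϑ e))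
    (hr0 : 0 ≤ r) (hϑr : ∀ e, ‖datVec ϑ e‖ ≤ r) (hϑ2 : ∀ e, ∑ c, ϑ c e ^ 2 ≤ r ^ 2)
    (hforest : ∀ x : Site 4, (∀ k : Fin 4, 1 ≤ x k ∧ x k + 1 ≤ 2 * (H : ℤ)) → ∀ c, ϑ c (x, 0) = 0)
    (hE : ∑ c, formM (fun e => e ∉ dirFreeEdges H) dirCorner (2 * H + 3) (ϑ c) (s c) ≤ B)
    (hpY : (boxKernelG ρ β H (forestFix H (glueWith (boxEdgesAt dirCorner (2 * H + 3))
      (fun e' : ↥(boxEdgesAt dirCorner (2 * H + 3)) => gaugeTransformZd g ω e'.1) (fun _ => 1)))).real (coldGoodSetG ρ H β ε)ᶜ ≤ pY)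
    (hpY1 : pY < 1)
    (hrm : r ≤ m) (hm4 : m ≤ 1 / 4)
    (hball : ∀ u : G, ‖ρ u - 1‖ ≤ (12 * (H : ℝ) ^ 2 + 2 * H + 1) * (Real.sqrt 2 * Real.sqrt (β ^ (2 * ε - 1)) + 8 * r) →
      u ∈ expChart ρ '' closedBall (0 : EuclideanSpace ℝ (Fin (dimE ρ))) m)
    {J : EuclideanSpace ℝ (Fin (dimE ρ)) → ℝ} (hJm : Measurable J) (hgpos : ∀ a, ‖a‖ ≤ m → 0 < J a) (hℓ0 : 0 ≤ ℓ)
    (hg : ∀ a, ‖a‖ ≤ m → |Real.log (J a)| ≤ ℓ) {c : ℝ≥0∞} (hc0 : c ≠ 0) (hctop : c ≠ ∞)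
    (hdens : (chartMeasureE ρ (1 / 4)).restrict (closedBall 0 m) =
      (c • (volume : Measure (EuclideanSpace ℝ (Fin (dimE ρ)))).restrict (closedBall 0 m)).withDensity (fun a => ENNReal.ofReal (J a)))
    (hR0 : 0 ≤ R) (hR' : Real.sqrt (β * B) + 4 * (Real.sqrt β * r) ≤ R')
    (hmEm : Real.sqrt (dimE ρ) * ((12 * (H : ℝ) ^ 2 + 2 * H + 1) * ((R + R') + 4 * (Real.sqrt β * r))) / Real.sqrt β ≤ m)
    (hwin : (dimE ρ : ℝ) / 2 * (R + R') ^ 2 / β + 190 * m ^ 3 < β ^ (2 * ε - 1))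
    (hP2 : 240 * (dimE ρ : ℝ) * (2 * (H : ℝ) + 1) ^ 4 * Real.exp (-R ^ 2 / 2) ≤ 1 / 2)
    {x : Site 4} (hx : ∀ k : Fin 4, 8 * |x k - (H : ℤ)| ≤ (H : ℤ)) :
    |β * (∫ U, plaqCostAt ρ x 1 2 U ∂(boxKernelG ρ β H ω)) -
        (dimE ρ : ℝ) / 2 * boxDirProjKernel H (x, 1, 2) (x, 1, 2) -
        β * ∑ c, sCirc (glue (pin := fun e => e ∉ dirFreeEdges H) dirCorner (2 * H + 3) ((1 / Real.sqrt 2) • ϑ c)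
            (mean (fun e => e ∉ dirFreeEdges H) dirCorner (2 * H + 3) ((1 / Real.sqrt 2) • ϑ c))) (x, 1, 2) ^ 2| ≤
      2 * (2 * N * β) * pY +
        (β ^ (2 * ε) * (Real.exp (2 * (120 * (2 * (H : ℝ) + 1) ^ 4 * (190 * β * m ^ 3) + 4 * (2 * (H : ℝ) + 1) ^ 4 * ℓ)) - 1) +
          190 * β * m ^ 3 +
          2 * (1 + 2 * (dimE ρ : ℝ) ^ 2 * (R' ^ 4 + 3)) * Real.sqrt (240 * (dimE ρ : ℝ) * (2 * (H : ℝ) + 1) ^ 4 * Real.exp (-R ^ 2 / 2))) := by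
  have hβ0 : 0 < β := by linarith only [hβ1]
  have hR'0 : 0 ≤ R' := le_trans (by positivity) hR'
  have hτ0 : 0 ≤ 190 * β * m ^ 3 := by
    have hm0 : 0 ≤ m := hr0.trans hrm
    positivity
  -- the truncated gauge copy
  set W : LGConfig 4 G := forestFix H (glueWith (boxEdgesAt dirCorner (2 * H + 3))
    (fun e' : ↥(boxEdgesAt dirCorner (2 * H + 3)) => gaugeTransformZd g ω e'.1) (fun _ => 1)) with hWdef
  have hW : ∀ e, e ∉ boxEdges 4 (2 * H + 1) → W e = expChart ρ (datVec ϑ e) := fun e _ => hWall e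
  have hϑ : ∀ e, e ∉ boxEdges 4 (2 * H + 1) → ‖datVec ϑ e‖ ≤ r := fun e _ => hϑr e
  have hϑ2' : ∀ e, e ∉ boxEdges 4 (2 * H + 1) → ∑ c, ϑ c e ^ 2 ≤ r ^ 2 := fun e _ => hϑ2 e
  -- ## the background bound (all plaquettes)
  have hF : ∀ (c : Fin (dimE ρ)) (p : ZdPlaquette 4), |sCirc (glue (pin := fun e => e ∉ dirFreeEdges H) dirCorner (2 * H + 3) (sdatE β ϑ c)
      (mean (fun e => e ∉ dirFreeEdges H) dirCorner (2 * H + 3) (sdatE β ϑ c))) (p.1, p.2.1.1, p.2.1.2)| ≤ R' :=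
    fun c p => (abs_dirBackground_sdatE_le (H := H) hβ0.le hr0 hϑ2' hforest s hE c p).trans hR'
  -- ## the Gaussian window `S` and its real inputs
  set S : Set (TSpaceD H (dimE ρ)) := goodTDE ρ H β ε ϑ ∩
    {t | ∀ e, ‖unscaleTE H (dimE ρ) β (t + meanTE H (dimE ρ) β ϑ) e‖ ≤ m} with hSdef
  have hPS : (gaussD H (dimE ρ)).real Sᶜ ≤ 240 * (dimE ρ : ℝ) * (2 * (H : ℝ) + 1) ^ 4 * Real.exp (-R ^ 2 / 2) :=
    gaussD_real_compl_goodTDE_inter_ball_le ρ hρc hβ0 hH hr0 hR0 hR'0 hϑ hforest hF hmEm hrm hm4 hwin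
  have hcoord : ∀ t ∈ S, ∀ e, ‖extDatum (datVec ϑ) (unscaleTE H (dimE ρ) β (t + meanTE H (dimE ρ) β ϑ)) e‖ ≤ m :=
    fun t ht e => norm_extDatum_le_of_window ρ ϑ _ hr0 hrm hϑ2' ht.2 e
  have hWb : ∀ t ∈ S, |tiltWDE ρ H J β ϑ t| ≤ 120 * (2 * (H : ℝ) + 1) ^ 4 * (190 * β * m ^ 3) + 4 * (2 * (H : ℝ) + 1) ^ 4 * ℓ :=
    fun t ht => (abs_tiltWDE_le ρ hρc hβ0 hm4 hg hforest t (hcoord t ht)).trans (tiltSize_le_cardBound H hτ0 hℓ0)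
  have hxT := Summit.QuantumFields.YangMills.Theorems.WeakCouplingRates.near_centre_mem_plaquettesTouching hH hx
  have hSur : ∀ t ∈ S, |qObsDE H (dimE ρ) β ϑ (x, 1, 2) t - β * plaqCostAt ρ x 1 2 (cfgTDE ρ H β ϑ t)| ≤ 190 * β * m ^ 3 := fun t ht => by
    have h := abs_beta_mul_plaqCostAt_sub_qObsDE_le ρ hρc hβ0 hm4 hforest t (hcoord t ht) hxT
    rw [abs_sub_comm] at h
    exact h
  have hFx : ∀ c, |sCirc (glue (pin := fun e => e ∉ dirFreeEdges H) dirCorner (2 * H + 3) (sdatE β ϑ c)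
      (mean (fun e => e ∉ dirFreeEdges H) dirCorner (2 * H + 3) (sdatE β ϑ c))) (x, 1, 2)| ≤ R' := fun c => by
    have h := hF c ((x, ⟨((1 : Fin 4), (2 : Fin 4)), by decide⟩) : ZdPlaquette 4)
    exact h
  -- ## the mean core at `W`
  have hcore := abs_kernelMeanG_sub_gaussian_le_datum ρ hρc hinj hρu hJm hβ1 hH hr0 hm4 hW hϑ hball
    hgpos hc0 hctop hdens hpY hpY1 hPS hP2 hWb (show (1 : Fin 4) < 2 by decide) hxT hSur hFx
  -- ## transport of the kernel mean from `ω` to `W`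
  have h12 : (1 : Fin 4) ≠ 2 := by decide
  rw [integral_plaqCostAt_boxKernelG_eq_of_gauge_trunc_of_near_centre ρ hρc β hH ω g hx h12]
  -- ## units: the core's constant term is the interface's
  have hconst : 1 / 2 * ∑ c, (sCirc (glue (pin := fun e => e ∉ dirFreeEdges H) dirCorner (2 * H + 3) (sdatE β ϑ c)
        (mean (fun e => e ∉ dirFreeEdges H) dirCorner (2 * H + 3) (sdatE β ϑ c))) (x, 1, 2)) ^ 2 =
      β * ∑ c, sCirc (glue (pin := fun e => e ∉ dirFreeEdges H) dirCorner (2 * H + 3) ((1 / Real.sqrt 2) • ϑ c)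
          (mean (fun e => e ∉ dirFreeEdges H) dirCorner (2 * H + 3) ((1 / Real.sqrt 2) • ϑ c))) (x, 1, 2) ^ 2 := by
    simp_rw [dirBackground_sdatE_eq]
    rw [half_sum_sq_sqrt_smul_eq hβ0.le, half_beta_sum_dirBackground_sq_eq]
  rw [hconst] at hcore
  have e : ∀ (X V Fs : ℝ), X - (dimE ρ : ℝ) / 2 * V - Fs = X - ((dimE ρ : ℝ) / 2 * V + Fs) := fun X V Fs => by ring
  rw [e]
  exact hcore

end Box

end Summit.QuantumFields.YangMills.Theorems.ColdBoxAllGroups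

end
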